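import Mathlib
import HarnessLib
import Summits.CriticalPhenomena.CardyFormulaZ2.Theses.CardySelfDualSegment
import Literature.Probability.Percolation.CornerPercolation
import Literature.Barriers.CriticalPhenomena.EmbeddingModulusUniqueness
import Summits.CriticalPhenomena.CardyFormulaZ2.Theorems.CardySelfDualSegmentSegmentOpenStubCrossingProbPolynomial
import Summits.CriticalPhenomena.CardyFormulaZ2.Theorems.CardySelfDualSegmentSegmentOpenStubShearCrossRatioAnalytic

/-!
# Crux `SegmentOpen` (stmt-CriticalPhenomena-5471), line `Sketch` — stub `stub_goodSetNhdsZero_of_jets` (GZ)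

Lead c4's glue stub of reshape 6 (SMIRNOV JET).  Statement (registered verbatim):

  VJ (Vitali with jets) → S4s (uniform complex bound at small mesh) → SJ (Smirnov jet) →
  `∃ r > 0, [0, r) ⊆ G`,

where `G = {t | ∃ α, 0 < im α ∧ CardyMod t α}` is the good set of route `CardySelfDualSegment`.
All three hypotheses are the registered stubs of `Cruxes/SegmentOpen/Lines/Sketch.lean`, taken
verbatim as hypotheses (nothing is claimed about them here); S1 (`stub_crossingProbPolynomial`,
p97364) and S7 (`stub_shearCrossRatioAnalytic`, p130521) are the landed theorems.

Proof.  Fix `t < min r r₀` and sheared data `(R, R', φ, x)` at modulus `α t`; S7 gives the modulus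
function `M` of `R'` with `crossRatio x = M (α t)`, SJ the coefficient limits `a k` with
`Σ a k t^k = F (M (α t))`.  To show `P_t(R', δ) → F(M(α t))` as `δ → 0⁺` it suffices to treat
sequences `d n → 0⁺` (`tendsto_iff_seq_tendsto`).  The complex crossing polynomials
`F n = p_{d n}` (S1; `0` for the finitely many inadmissible `n`) are entire, bounded by `C` on
`B(0, r)` (S4s at `t₀ = 0`), and `iteratedDeriv k (F n) 0 = k! · coeff_k (p_{d n}) → k! · a k`
(SJ); so VJ gives a holomorphic `g` on the ball with `F n → g` locally uniformly and
`iteratedDeriv k g 0 = k! · a k`.  Taylor's theorem on the ball (`Complex.hasSum_taylorSeries_on_ball`)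
gives `g t = Σ a k t^k = F(M(α t))`, whence `P_t(R', d n) = F n t → F(M(α t))`.
-/

noncomputable section

namespace Summit.CriticalPhenomena.CardyFormulaZ2.Theorems

open Literature.Probability Literature.Barriers.CriticalPhenomena
open Literature.Probability.RandomPlanarGeometry (ConformalRectangle ConformalEquiv MarkedDomain)
open Filter Set Topology MeasureTheory
open UpperHalfPlane (upperHalfPlaneSet)

namespace GoodSetNhdsZeroOfJets

/-- Iterated derivatives of a complex polynomial function are the evaluations of the iterated
formal derivatives. -/
theorem iteratedDeriv_eval (q : Polynomial ℂ) (k : ℕ) :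
    iteratedDeriv k (fun z => q.eval z) = fun z => (Polynomial.derivative^[k] q).eval z := by
  -- adapted from Literature/Analysis/Complex/AnalyticFormalRoots.lean (`iteratedDeriv_polynomial_eval`)
  induction k with
  | zero => simp
  | succ k ih =>
    rw [iteratedDeriv_succ, ih, Function.iterate_succ_apply']
    funext z
    exact Polynomial.deriv _

/-- The `k`-th derivative at `0` of a complex polynomial function is `k! · coeff_k`. -/
theorem iteratedDeriv_eval_zero (q : Polynomial ℂ) (k : ℕ) :
    iteratedDeriv k (fun z => q.eval z) 0 = (k.factorial : ℂ) * q.coeff k := by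
  rw [iteratedDeriv_eval]
  dsimp only
  rw [← Polynomial.coeff_zero_eq_eval_zero, Polynomial.coeff_iterate_derivative, zero_add,
    Nat.descFactorial_self, nsmul_eq_mul]

/-- For a real polynomial `p` mapped to `ℂ`, the `k`-th derivative at `0` is `k! · coeff_k p`. -/
theorem iteratedDeriv_map_eval_zero (p : Polynomial ℝ) (k : ℕ) :
    iteratedDeriv k (fun z => (p.map (algebraMap ℝ ℂ)).eval z) 0 =
      (k.factorial : ℂ) * ((p.coeff k : ℝ) : ℂ) := by
  rw [iteratedDeriv_eval_zero, Polynomial.coeff_map]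
  rfl

/-- **Convergence along one sequence of meshes.**  The analytic core of GZ: given VJ, a uniform
bound `C` for the complex crossing polynomials `P δ` (`0 < δ < δ₁`) on the disc `B(0, r)`,
convergence of their coefficients `coeff_k (P δ) → a k` as `δ → 0⁺`, and the value
`Σ a k s^k = L` at a real point `0 ≤ s < r`, the real evaluations `(P (d n)).eval s` converge to
`L` along every sequence of meshes `d n → 0⁺`. -/
theorem tendsto_eval_of_jets
    (hVJ : ∀ (U : Set ℂ), IsOpen U → IsPreconnected U → ∀ z₀ ∈ U, ∀ (F : ℕ → ℂ → ℂ) (c : ℕ → ℂ),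
      (∀ n, DifferentiableOn ℂ (F n) U) →
      (∀ a ∈ U, ∃ M : ℝ, ∃ r > 0, ∀ n, ∀ z ∈ Metric.ball a r ∩ U, ‖F n z‖ ≤ M) →
      (∀ k : ℕ, Tendsto (fun n => iteratedDeriv k (F n) z₀) atTop (𝓝 (c k))) →
      ∃ f : ℂ → ℂ, DifferentiableOn ℂ f U ∧ TendstoLocallyUniformlyOn F f atTop U ∧
        ∀ k : ℕ, iteratedDeriv k f z₀ = c k)
    {r δ₁ C : ℝ} (hr : 0 < r) (hδ₁ : 0 < δ₁) (P : ℝ → Polynomial ℝ)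
    (hC : ∀ δ : ℝ, 0 < δ → δ < δ₁ →
      ∀ z ∈ Metric.ball (0 : ℂ) r, ‖((P δ).map (algebraMap ℝ ℂ)).eval z‖ ≤ C)
    {a : ℕ → ℝ}
    (ha : ∀ k : ℕ, ∀ ε > 0, ∃ δ₀ > 0, ∀ δ : ℝ, 0 < δ → δ < δ₀ → |(P δ).coeff k - a k| < ε)
    {s : ℝ} (hs0 : 0 ≤ s) (hsr : s < r) {L : ℝ} (hL : HasSum (fun k : ℕ => a k * s ^ k) L)
    {d : ℕ → ℝ} (hd : Tendsto d atTop (𝓝[>] 0)) :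
    Tendsto (fun n => (P (d n)).eval s) atTop (𝓝 L) := by
  classical
  -- admissible meshes, eventually all of them
  have hgood : ∀ᶠ n in atTop, 0 < d n ∧ d n < δ₁ := by
    have h1 : ∀ᶠ n in atTop, d n ∈ Ioo 0 δ₁ := hd (Ioo_mem_nhdsGT hδ₁)
    exact h1.mono fun n hn => hn
  -- the holomorphic sequence on the disc
  set U : Set ℂ := Metric.ball (0 : ℂ) r with hU
  set F : ℕ → ℂ → ℂ := fun n =>
    if 0 < d n ∧ d n < δ₁ then fun z => ((P (d n)).map (algebraMap ℝ ℂ)).eval z else 0 with hF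
  have hFgood : ∀ n, 0 < d n ∧ d n < δ₁ →
      F n = fun z => ((P (d n)).map (algebraMap ℝ ℂ)).eval z := fun n hn => by
    simp only [hF, if_pos hn]
  have hFbad : ∀ n, ¬ (0 < d n ∧ d n < δ₁) → F n = 0 := fun n hn => by
    simp only [hF, if_neg hn]
  have hUo : IsOpen U := Metric.isOpen_ball
  have hUc : IsPreconnected U := (convex_ball (0 : ℂ) r).isPreconnected
  have h0U : (0 : ℂ) ∈ U := Metric.mem_ball_self hr
  have hFd : ∀ n, DifferentiableOn ℂ (F n) U := fun n => by
    by_cases hn : 0 < d n ∧ d n < δ₁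
    · rw [hFgood n hn]
      exact (Polynomial.differentiable _).differentiableOn
    · rw [hFbad n hn]
      exact differentiableOn_const 0
  have hFb : ∀ w ∈ U, ∃ M : ℝ, ∃ ρ > 0, ∀ n, ∀ z ∈ Metric.ball w ρ ∩ U, ‖F n z‖ ≤ M := by
    intro w _
    refine ⟨max C 0, 1, one_pos, fun n z hz => ?_⟩
    by_cases hn : 0 < d n ∧ d n < δ₁
    · rw [hFgood n hn]
      exact (hC (d n) hn.1 hn.2 z hz.2).trans (le_max_left _ _)
    · rw [hFbad n hn]
      simp
  -- the jets at `0` converge to `k! · a k`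
  have hcoeff : ∀ k : ℕ, Tendsto (fun n => (P (d n)).coeff k) atTop (𝓝 (a k)) := by
    intro k
    rw [Metric.tendsto_nhds]
    intro ε hε
    obtain ⟨δ₀, hδ₀, hδ⟩ := ha k ε hε
    have h1 : ∀ᶠ n in atTop, d n ∈ Ioo 0 δ₀ := hd (Ioo_mem_nhdsGT hδ₀)
    exact h1.mono fun n hn => hδ (d n) hn.1 hn.2
  have hjet : ∀ k : ℕ, Tendsto (fun n => iteratedDeriv k (F n) 0) atTop
      (𝓝 ((k.factorial : ℂ) * ((a k : ℝ) : ℂ))) := by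
    intro k
    have h1 : Tendsto (fun n => (k.factorial : ℂ) * (((P (d n)).coeff k : ℝ) : ℂ)) atTop
        (𝓝 ((k.factorial : ℂ) * ((a k : ℝ) : ℂ))) :=
      ((Complex.continuous_ofReal.tendsto (a k)).comp (hcoeff k)).const_mul _
    refine h1.congr' ?_
    filter_upwards [hgood] with n hn
    rw [hFgood n hn, iteratedDeriv_map_eval_zero]
  -- Vitali with jets
  obtain ⟨g, hgd, hgF, hgjet⟩ := hVJ U hUo hUc 0 h0U F _ hFd hFb hjet
  -- Taylor expansion of the limit at `0`, evaluated at `s`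
  have hsU : (s : ℂ) ∈ U := by
    rw [hU, Metric.mem_ball, dist_zero_right, Complex.norm_real, Real.norm_eq_abs,
      abs_of_nonneg hs0]
    exact hsr
  have hT := Complex.hasSum_taylorSeries_on_ball hgd hsU
  have hfun : (fun n : ℕ => (n.factorial : ℂ)⁻¹ • ((s : ℂ) - 0) ^ n • iteratedDeriv n g 0) =
      fun k : ℕ => (((a k * s ^ k : ℝ)) : ℂ) := by
    funext k
    rw [hgjet k, sub_zero, smul_eq_mul, smul_eq_mul]
    have hk : (k.factorial : ℂ) ≠ 0 := by exact_mod_cast Nat.factorial_ne_zero k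
    push_cast
    field_simp
  rw [hfun] at hT
  have hLc : HasSum (fun k : ℕ => (((a k * s ^ k : ℝ)) : ℂ)) ((L : ℝ) : ℂ) :=
    (Complex.hasSum_ofReal (L := SummationFilter.unconditional ℕ)).2 hL
  have hgs : g s = (L : ℂ) := hT.unique hLc
  -- pointwise convergence at `s`
  have hpt : Tendsto (fun n => F n s) atTop (𝓝 (g s)) := hgF.tendsto_at hsU
  rw [hgs] at hpt
  have hpt' : Tendsto (fun n => (((P (d n)).eval s : ℝ) : ℂ)) atTop (𝓝 (L : ℂ)) := by
    refine hpt.congr' ?_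
    filter_upwards [hgood] with n hn
    rw [hFgood n hn]
    -- a real polynomial mapped to `ℂ`, evaluated at a real point, is the real evaluation
    change ((P (d n)).map (algebraMap ℝ ℂ)).eval (algebraMap ℝ ℂ s) =
      algebraMap ℝ ℂ ((P (d n)).eval s)
    rw [Polynomial.eval_map, Polynomial.eval₂_at_apply]
  have hre := (Complex.continuous_re.tendsto (L : ℂ)).comp hpt'
  rw [Complex.ofReal_re] at hre
  exact hre.congr fun n => by simp

end GoodSetNhdsZeroOfJets

open GoodSetNhdsZeroOfJets in
/-- **GZ — jets ⇒ a neighbourhood of the Smirnov point is good.**  From VJ (Vitali with jets),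
S4s (uniform complex bound of the crossing polynomials at small mesh) and SJ (the Smirnov jet:
coefficient limits `a k` and `Σ a k t^k = F(M(α t))`), all hypotheses verbatim the registered
stubs of line `Sketch`, there is `r > 0` such that every `t ∈ [0,1]` with `t < r` is a good
point, with modulus `α t`: for sheared data `(R, R', φ, x)` at `α t`, S7 gives
`crossRatio x = M (α t)`, and along every sequence of meshes `d n → 0⁺` the crossing
probabilities `P_t(R', d n)` converge to `Σ a k t^k = F(M(α t))` (`tendsto_eval_of_jets`). -/
theorem stub_goodSetNhdsZero_of_jets :
    (∀ (U : Set ℂ), IsOpen U → IsPreconnected U → ∀ z₀ ∈ U, ∀ (F : ℕ → ℂ → ℂ) (c : ℕ → ℂ),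
      (∀ n, DifferentiableOn ℂ (F n) U) →
      (∀ a ∈ U, ∃ M : ℝ, ∃ r > 0, ∀ n, ∀ z ∈ Metric.ball a r ∩ U, ‖F n z‖ ≤ M) →
      (∀ k : ℕ, Tendsto (fun n => iteratedDeriv k (F n) z₀) atTop (𝓝 (c k))) →
      ∃ f : ℂ → ℂ, DifferentiableOn ℂ f U ∧ TendstoLocallyUniformlyOn F f atTop U ∧
        ∀ k : ℕ, iteratedDeriv k f z₀ = c k) →
    (∀ t₀ : unitInterval, ∃ r > 0, ∀ R : ConformalRectangle, ∃ δ₁ > 0, ∃ C : ℝ, ∀ δ : ℝ,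
      0 < δ → δ < δ₁ → ∀ p : Polynomial ℝ,
        (∀ t : unitInterval, Percolation.cornerCrossingProb t R δ = p.eval (t : ℝ)) →
        ∀ z ∈ Metric.ball ((t₀ : ℝ) : ℂ) r, ‖(p.map (algebraMap ℝ ℂ)).eval z‖ ≤ C) →
    (∃ r₀ > 0, ∃ α : unitInterval → ℂ, (∀ t : unitInterval, (t : ℝ) < r₀ → 0 < (α t).im) ∧
      ∀ (R' : ConformalRectangle) (M : ℂ → ℝ), AnalyticOnNhd ℝ M {β : ℂ | 0 < β.im} →
        (∀ β : ℂ, 0 < β.im → ∀ (R : ConformalRectangle)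
            (φ : ConformalEquiv UpperHalfPlane.upperHalfPlaneSet R.carrier) (x : Fin 4 → ℝ),
            R.carrier = moduliShear β '' R'.carrier → (∀ i, R.pt i = moduliShear β (R'.pt i)) →
            R.IsUniformizing φ x → RandomPlanarGeometry.crossRatio x = M β) →
        ∃ a : ℕ → ℝ,
          (∀ k : ℕ, ∀ ε > 0, ∃ δ₀ > 0, ∀ δ : ℝ, 0 < δ → δ < δ₀ → ∀ p : Polynomial ℝ,
              (∀ t : unitInterval, Percolation.cornerCrossingProb t R' δ = p.eval (t : ℝ)) →
              |p.coeff k - a k| < ε) ∧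
          ∀ t : unitInterval, (t : ℝ) < r₀ →
            HasSum (fun k : ℕ => a k * (t : ℝ) ^ k)
              (RandomPlanarGeometry.cardyFunction (M (α t)))) →
    ∃ r > 0, ∀ t : unitInterval, (t : ℝ) < r →
      t ∈ {t : unitInterval | ∃ α : ℂ, 0 < α.im ∧
        ∀ (R R' : ConformalRectangle)
          (φ : ConformalEquiv UpperHalfPlane.upperHalfPlaneSet R.carrier) (x : Fin 4 → ℝ),
          R.carrier = moduliShear α '' R'.carrier → (∀ i, R.pt i = moduliShear α (R'.pt i)) →
          R.IsUniformizing φ x →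
          Tendsto (Percolation.cornerCrossingProb t R') (𝓝[>] 0)
            (𝓝 (RandomPlanarGeometry.cardyFunction (RandomPlanarGeometry.crossRatio x)))} := by
  classical
  intro hVJ h4 hSJ
  obtain ⟨r₀, hr₀, α, hα, hJ⟩ := hSJ
  obtain ⟨r, hr, hR⟩ := h4 0
  refine ⟨min r r₀, lt_min hr hr₀, fun t ht => ?_⟩
  have htr : (t : ℝ) < r := lt_of_lt_of_le ht (min_le_left _ _)
  have htr₀ : (t : ℝ) < r₀ := lt_of_lt_of_le ht (min_le_right _ _)
  refine ⟨α t, hα t htr₀, ?_⟩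
  intro R R' φ x hcar hpt hunif
  -- the modulus function of `R'` (S7) and the Smirnov jet of `R'` (SJ)
  obtain ⟨M, hMan, hM⟩ := stub_shearCrossRatioAnalytic R'
  have hcr : RandomPlanarGeometry.crossRatio x = M (α t) :=
    hM (α t) (hα t htr₀) R φ x hcar hpt hunif
  obtain ⟨a, hconv, hsum⟩ := hJ R' M hMan hM
  -- the uniform bound at `t₀ = 0` for `R'` (S4s), crossing polynomials from S1
  obtain ⟨δ₁, hδ₁, C, hC⟩ := hR R'
  have h00 : (((0 : unitInterval) : ℝ) : ℂ) = 0 := by simp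
  rw [h00] at hC
  set P : ℝ → Polynomial ℝ := fun δ =>
    if h : 0 < δ then Classical.choose (stub_crossingProbPolynomial R' δ h) else 0 with hP
  have hPspec : ∀ δ : ℝ, 0 < δ → ∀ s : unitInterval,
      Percolation.cornerCrossingProb s R' δ = (P δ).eval (s : ℝ) := fun δ hδ => by
    simp only [hP, dif_pos hδ]
    exact Classical.choose_spec (stub_crossingProbPolynomial R' δ hδ)
  rw [hcr]
  -- reduce to sequences of meshes
  rw [tendsto_iff_seq_tendsto]
  intro d hd
  have key := tendsto_eval_of_jets hVJ hr hδ₁ P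
    (fun δ hδ hδ' z hz => hC δ hδ hδ' (P δ) (hPspec δ hδ) z hz)
    (fun k ε hε => by
      obtain ⟨δ₀, hδ₀, h⟩ := hconv k ε hε
      exact ⟨δ₀, hδ₀, fun δ hδ hδ' => h δ hδ hδ' (P δ) (hPspec δ hδ)⟩)
    (unitInterval.nonneg t) htr (hsum t htr₀) hd
  -- `P_t(R', d n) = (P (d n)).eval t` for the admissible `n`
  have hgood : ∀ᶠ n in atTop, 0 < d n := by
    have h1 : ∀ᶠ n in atTop, d n ∈ Ioi 0 := hd self_mem_nhdsWithin
    exact h1.mono fun n hn => hn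
  refine key.congr' ?_
  filter_upwards [hgood] with n hn
  exact (hPspec (d n) hn t).symm

end Summit.CriticalPhenomena.CardyFormulaZ2.Theorems
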